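import Summits.ValiantsHypothesis.ValiantsHypothesis.Theorems.SymPencilSdcPerFourTwentySix
import Summits.ValiantsHypothesis.ValiantsHypothesis.Theorems.SymPencilKernelInvariance
import Literature.Computability.AlgebraicComplexity.PerStabilizerMarcusMayProofs

/-!
# Route `SymPencil` — `sdc(per_4) ≥ 27` given the six-dimensional cell hypothesis `H106₅`
# (BOTH one-row cells `(12, 4, 0)` and `(12, 4, 1)` are DEAD)  (`--supports`
# stmt-ValiantsHypothesis-5674 `SdcSuperquadratic`; rung currency only — nothing here bears on
# `VP ≠ VNP`)

**Theorem** (`twentySeven_le_of_H106₅`).  Assume `H106₅` (no `6`-dimensional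
`V ⊆ Sing Z(per_4)` carries a joint family with five squares; val-width-5674-p3's lane).  Then
every symmetric affine determinantal representation of `per_4` over a field of characteristic `0`
has size `≥ 27`; equivalently `27 ≤ sdc(per₄)` given `H106₅`
(`sdc_perPoly_four_twentySeven_le_of_H106₅`; the tree's upper bound is `29`).

NEW and unconditional (`false_of_rank_twelve_le_twentySix`): in the base-point package of a
symmetric representation of size `m ≤ 26`, the space of kernel rows is NOT `12`-dimensional —
the cells `(12,4,0)` (size `25`, Lagrangian, `SymPencilSdcPerFourTwentySix`) and `(12,4,1)` (size
`26`, defect one) are both empty.  For the defect-one cell the kernel invariance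
`C(v) D⁻¹ (im b) ⊆ im b` is no longer automatic; it follows from
`SymPencilKernelInvariance.mulVec_mem_range_of_isotropic` once the vectors `C(v) D⁻¹ b(z)` are
known to be `D⁻¹`-isotropic, and THAT is the `s²`-coefficient of the second origin moment
`det D · bᵀ D⁻¹ C D⁻¹ C D⁻¹ b (z + s v) = -κ per_4 (z + s v)` — affine in `s` because `v` is a
one-row (one-column) matrix (`dotProduct_eq_zero_of_affine`, `affine_of_row`, `affine_of_col`).
With the invariance in hand the one-row / one-column kills of `SymPencilPerFourOneRowCells`
apply verbatim.

Honest framing: `H106₅` is OPEN; the tree's unconditional window stays `25 ≤ sdc(per₄) ≤ 29`;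
given `H106₅` the window is `27 ≤ sdc(per₄) ≤ 29`, i.e. the open sizes are `27, 28` (where the
kernel-package table acquires the cells `(13, 3, ·)` and two-square one-row families); the crux
`SdcSuperquadratic` and `VP ≠ VNP` are untouched.  No definitions, no named facts. [folklore]
-/

noncomputable section

-- single-conjunct layout: Sub = Summit, duplicated namespace component intended
set_option linter.dupNamespace false

namespace Summit.ValiantsHypothesis.ValiantsHypothesis.Theorems.SymPencilSdcPerFourTwentySeven

open Matrix MvPolynomial Module
open Literature.Computability.AlgebraicComplexity
open Summit.ValiantsHypothesis.ValiantsHypothesis.Theorems.SymPencilPerFourBasePointPackage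
open Summit.ValiantsHypothesis.ValiantsHypothesis.Theorems.SymPencilPerFourOneRowCells
open Summit.ValiantsHypothesis.ValiantsHypothesis.Theorems.SymPencilLagrangianKernel
open Summit.ValiantsHypothesis.ValiantsHypothesis.Theorems.SymPencilKernelInvariance
open Summit.ValiantsHypothesis.ValiantsHypothesis.Theorems.SymPencilIsotropicKernelSquaresBilinear
open Summit.ValiantsHypothesis.ValiantsHypothesis.Theorems.SymPencilPerFourHessianBlocks
open Summit.ValiantsHypothesis.ValiantsHypothesis.Theorems.SymPencilPerFourLowRankSevenSharp
open Summit.ValiantsHypothesis.ValiantsHypothesis.Theorems.SymPencilBoxFourEquality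
open Summit.ValiantsHypothesis.ValiantsHypothesis.Theorems.SymPencilSdcPerFourInnerRankNineSquares
open Summit.ValiantsHypothesis.ValiantsHypothesis.Theorems.SymPencilPerFourBlocksEq

variable (K : Type*) [Field K] [CharZero K]

omit [CharZero K] in
/-- `per_4 (z + s v)` is affine in `s` for a one-ROW matrix `v`. [folklore] -/
theorem affine_of_row (l : Fin 4) (v : Fin 4 × Fin 4 → K) (hv : ∀ i j, i ≠ l → v (i, j) = 0)
    (z : Fin 4 × Fin 4 → K) :
    ∃ e₀ e₁ : K, ∀ s : K, eval (z + s • v) (perPoly (Fin 4) K) = e₀ + s * e₁ := by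
  set Z : Matrix (Fin 4) (Fin 4) K := Matrix.of fun i j => z (i, j) with hZ
  set a : Fin 4 → K := fun j => v (l, j) with ha
  have hM : ∀ s : K, (Matrix.of fun i j => (z + s • v) (i, j)) =
      Z + s • (0 : Matrix (Fin 4) (Fin 4) K).updateRow l a := by
    intro s
    ext i j
    by_cases h : i = l
    · subst h; simp [hZ, ha]
    · simp [hZ, h, hv i j h]
  refine ⟨Z.permanent, (Z + (0 : Matrix (Fin 4) (Fin 4) K).updateRow l a).permanent - Z.permanent,
    fun s => ?_⟩
  rw [eval_perPoly, hM, MarcusMay.permanent_add_smul_row]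
  ring

omit [CharZero K] in
/-- `per_4 (z + s v)` is affine in `s` for a one-COLUMN matrix `v`. [folklore] -/
theorem affine_of_col (c : Fin 4) (v : Fin 4 × Fin 4 → K) (hv : ∀ i j, j ≠ c → v (i, j) = 0)
    (z : Fin 4 × Fin 4 → K) :
    ∃ e₀ e₁ : K, ∀ s : K, eval (z + s • v) (perPoly (Fin 4) K) = e₀ + s * e₁ := by
  set Z : Matrix (Fin 4) (Fin 4) K := Matrix.of fun i j => z (i, j) with hZ
  set a : Fin 4 → K := fun i => v (i, c) with ha
  have hM : ∀ s : K, (Matrix.of fun i j => (z + s • v) (i, j)) =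
      Z + s • (0 : Matrix (Fin 4) (Fin 4) K).updateCol c a := by
    intro s
    ext i j
    by_cases h : j = c
    · subst h; simp [hZ, ha]
    · simp [hZ, h, hv i j h]
  refine ⟨Z.permanent, (Z + (0 : Matrix (Fin 4) (Fin 4) K).updateCol c a).permanent - Z.permanent,
    fun s => ?_⟩
  rw [eval_perPoly, hM, MarcusMay.permanent_add_smul_col]
  ring

variable {K}

/-- **The `s²`-coefficient of the second origin moment along an affine kernel direction**: if
`det D · b(z)ᵀ D⁻¹ C(z) D⁻¹ C(z) D⁻¹ b(z) = -κ per_4(z)` identically, `bL v = 0`, and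
`s ↦ per_4 (z + s v)` is affine for every `z`, then every `t = C(v) D⁻¹ b(z)` is `D⁻¹`-isotropic.
[folklore] -/
theorem dotProduct_eq_zero_of_affine {ι' : Type*} [Fintype ι'] [DecidableEq ι']
    {D : Matrix ι' ι' K} (hD : IsUnit D.det) (hDs : Dᵀ = D)
    (bL : (Fin 4 × Fin 4 → K) →ₗ[K] (ι' → K))
    (CL : (Fin 4 × Fin 4 → K) →ₗ[K] Matrix ι' ι' K) (hCs : ∀ z, (CL z)ᵀ = CL z) {κ : K}
    (hiii : ∀ z, D.det * (bL z ⬝ᵥ (D⁻¹ * CL z * D⁻¹ * CL z * D⁻¹) *ᵥ bL z) =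
      -(κ * eval z (perPoly (Fin 4) K)))
    (v : Fin 4 × Fin 4 → K) (hv : bL v = 0)
    (haff : ∀ z, ∃ e₀ e₁ : K, ∀ s : K, eval (z + s • v) (perPoly (Fin 4) K) = e₀ + s * e₁)
    (z : Fin 4 × Fin 4 → K) :
    (CL v *ᵥ (D⁻¹ *ᵥ bL z)) ⬝ᵥ D⁻¹ *ᵥ (CL v *ᵥ (D⁻¹ *ᵥ bL z)) = 0 := by
  have hDis : (D⁻¹)ᵀ = D⁻¹ := by rw [Matrix.transpose_nonsing_inv, hDs]
  obtain ⟨e₀, e₁, he⟩ := haff z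
  have h0 := hiii z
  have h1 := hiii (z + v)
  have h2 := hiii (z - v)
  have he1 := he 1
  have he2 := he (-1)
  rw [one_smul] at he1
  rw [neg_one_smul, ← sub_eq_add_neg] at he2
  rw [map_add, hv, add_zero, map_add, he1] at h1
  rw [map_sub, hv, sub_zero, map_sub, he2] at h2
  have he0 : eval z (perPoly (Fin 4) K) = e₀ := by simpa using he 0
  rw [he0] at h0
  -- second difference of the matrices
  have key : D⁻¹ * (CL z + CL v) * D⁻¹ * (CL z + CL v) * D⁻¹ +
      D⁻¹ * (CL z - CL v) * D⁻¹ * (CL z - CL v) * D⁻¹ =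
      (D⁻¹ * CL z * D⁻¹ * CL z * D⁻¹ + D⁻¹ * CL z * D⁻¹ * CL z * D⁻¹) +
      (D⁻¹ * CL v * D⁻¹ * CL v * D⁻¹ + D⁻¹ * CL v * D⁻¹ * CL v * D⁻¹) := by
    noncomm_ring
  have hsum : bL z ⬝ᵥ (D⁻¹ * (CL z + CL v) * D⁻¹ * (CL z + CL v) * D⁻¹) *ᵥ bL z +
      bL z ⬝ᵥ (D⁻¹ * (CL z - CL v) * D⁻¹ * (CL z - CL v) * D⁻¹) *ᵥ bL z -
      2 * (bL z ⬝ᵥ (D⁻¹ * CL z * D⁻¹ * CL z * D⁻¹) *ᵥ bL z) =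
      2 * (bL z ⬝ᵥ (D⁻¹ * CL v * D⁻¹ * CL v * D⁻¹) *ᵥ bL z) := by
    have h := congr_arg (fun M : Matrix ι' ι' K => bL z ⬝ᵥ M *ᵥ bL z) key
    simp only [Matrix.add_mulVec, dotProduct_add] at h
    linear_combination h
  rw [sandwich_eq hDis (hCs v)] at hsum
  have h3 : D.det * (2 * ((CL v *ᵥ (D⁻¹ *ᵥ bL z)) ⬝ᵥ D⁻¹ *ᵥ (CL v *ᵥ (D⁻¹ *ᵥ bL z)))) = 0 := by
    rw [← hsum]
    linear_combination h1 + h2 - 2 * h0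
  rcases mul_eq_zero.1 h3 with h | h
  · exact absurd h hD.ne_zero
  · exact (mul_eq_zero.1 h).resolve_left two_ne_zero

variable (K)

/-- **Both one-row cells `(12,4,0)` and `(12,4,1)` are empty** (unconditional): in the base-point
package of a symmetric affine determinantal representation of `per_4` of size `m ≤ 26`
(characteristic `0`), the space of kernel rows `im bL` is not `12`-dimensional. [folklore] -/
theorem false_of_rank_twelve_le_twentySix {m : ℕ} (hm : m ≤ 26)
    {i₀ : Fin m} {D : Matrix {i // i ≠ i₀} {i // i ≠ i₀} K}
    {bL : (Fin 4 × Fin 4 → K) →ₗ[K] ({i // i ≠ i₀} → K)}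
    {CL : (Fin 4 × Fin 4 → K) →ₗ[K] Matrix {i // i ≠ i₀} {i // i ≠ i₀} K} {κ : K}
    (hD : IsUnit D.det) (hDs : Dᵀ = D) (hCs : ∀ z, (CL z)ᵀ = CL z) (hκ : κ ≠ 0)
    (hi : ∀ z, bL z ⬝ᵥ D⁻¹ *ᵥ bL z = 0)
    (hii : ∀ z, bL z ⬝ᵥ (D⁻¹ * CL z * D⁻¹) *ᵥ bL z = 0)
    (hiii : ∀ z, D.det * (bL z ⬝ᵥ (D⁻¹ * CL z * D⁻¹ * CL z * D⁻¹) *ᵥ bL z) =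
      -(κ * eval z (perPoly (Fin 4) K)))
    (hcard : Fintype.card {i // i ≠ i₀} + 1 = m)
    (hrn : finrank K (LinearMap.range bL) + finrank K (LinearMap.ker bL) = 16)
    (hN : ∀ v, bL v = 0 → IsUnit (D + CL v).det ∧ ∀ (z : Fin 4 × Fin 4 → K) (s : K),
      κ * eval (v + s • z) (perPoly (Fin 4) K) =
        (Matrix.fromBlocks ((s * 0) • (1 : Matrix Unit Unit K))
          (Matrix.replicateRow Unit (s • bL z)) (Matrix.replicateCol Unit (s • bL z))
          (D + CL v + s • CL z)).det)
    (h12 : finrank K (LinearMap.range bL) = 12) : False := by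
  classical
  have hk4 : finrank K (LinearMap.ker bL) = 4 := by omega
  have hL : Fintype.card {i // i ≠ i₀} ≤ 2 * finrank K (LinearMap.range bL) + 1 := by omega
  -- a ONE-square family along the kernel, so the kernel is one row or one column
  obtain ⟨c, β, hcβ⟩ := sum_sq_of_isotropic_defect_bilinear hD hDs bL CL hCs
    (fun z => eval z (perPoly (Fin 4) K)) hκ hi hii hiii 1 (by omega)
  have hB : ∀ y ∈ LinearMap.ker bL, ∀ i k j l : Fin 4, i ≠ k → j ≠ l →
      y (i, j) * y (k, l) + y (i, l) * y (k, j) = 0 := fun y hy =>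
    perm_two_blocks_of_sum_sq_swap (ι := Fin 1) (by simp) y
      ⟨c, fun k => (β k).flip y, fun u => by
        obtain ⟨e₀, e₁, he⟩ := hcβ u y (LinearMap.mem_ker.1 hy)
        exact ⟨e₀, e₁, fun s => by simpa only [LinearMap.flip_apply] using he s⟩⟩
  rcases row_or_col_of_perm_two_blocks (LinearMap.ker bL) hB hk4 with ⟨l, hl⟩ | ⟨c', hc'⟩
  · have hinv0 : ∀ v, bL v = 0 → ∀ y ∈ LinearMap.range bL,
        CL v *ᵥ (D⁻¹ *ᵥ y) ∈ LinearMap.range bL := fun v hv y hy =>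
      mulVec_mem_range_of_isotropic hD hDs bL CL hCs hi hii hL v hv
        (dotProduct_eq_zero_of_affine hD hDs bL CL hCs hiii v hv
          (affine_of_row K l v (hl v (LinearMap.mem_ker.2 hv)))) y hy
    exact false_of_row_kernel hD hDs bL CL hCs hκ hii hN hinv0 l
      (fun x hx => hl x (LinearMap.mem_ker.2 hx)) hk4
  · have hinv0 : ∀ v, bL v = 0 → ∀ y ∈ LinearMap.range bL,
        CL v *ᵥ (D⁻¹ *ᵥ y) ∈ LinearMap.range bL := fun v hv y hy =>
      mulVec_mem_range_of_isotropic hD hDs bL CL hCs hi hii hL v hv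
        (dotProduct_eq_zero_of_affine hD hDs bL CL hCs hiii v hv
          (affine_of_col K c' v (hc' v (LinearMap.mem_ker.2 hv)))) y hy
    exact false_of_col_kernel hD hDs bL CL hCs hκ hii hN hinv0 c'
      (fun x hx => hc' x (LinearMap.mem_ker.2 hx)) hk4

/-- **`sdc(per_4) ≥ 27` given `H106₅`.**  See the module docstring. [folklore] -/
theorem twentySeven_le_of_H106₅
    (H106₅ : ∀ V : Submodule K (Fin 4 × Fin 4 → K),
      (∀ x ∈ V, ∀ (r c : Fin 3 → Fin 4), Function.Injective r → Function.Injective c →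
        ((Matrix.of fun i j => x (i, j)).submatrix r c).permanent = 0) →
      finrank K V = 6 → ∀ (c : Fin 5 → K)
        (β : Fin 5 → ((Fin 4 × Fin 4 → K) →ₗ[K] (Fin 4 × Fin 4 → K) →ₗ[K] K)),
      ¬ (∀ u : Fin 4 × Fin 4 → K, ∀ y ∈ V, ∃ e₀ e₁ : K, ∀ s : K,
          eval (u + s • y) (perPoly (Fin 4) K) = e₀ + s * e₁ + s ^ 2 * ∑ k, c k * (β k u y) ^ 2))
    {m : ℕ} {A : Matrix (Fin m) (Fin m) (MvPolynomial (Fin 4 × Fin 4) K)}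
    (hS : A.IsSymm) (hA : IsAffineDetRepr (perPoly (Fin 4) K) A) : 27 ≤ m := by
  classical
  by_contra hlt
  have hm : m ≤ 26 := by omega
  obtain ⟨i₀, D, bL, CL, κ, hD, hDs, hCs, hκ, hi, hii, hiii, hV4, hcard, hranle, hrn, hkerle,
    hN⟩ := basepoint_package_of_isSymm_isAffineDetRepr_perPoly_four K hS hA
  set V := LinearMap.ker bL with hVdef
  have hV3 : ∀ x ∈ V, ∀ (r c : Fin 3 → Fin 4), Function.Injective r → Function.Injective c →
      ((Matrix.of fun i j => x (i, j)).submatrix r c).permanent = 0 :=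
    fun x hx r c hr hc => subperm_vanish_inj_of_succAbove x (hV4 x hx) r c hr hc
  have family : ∀ d : ℕ, Fintype.card {i // i ≠ i₀} ≤ 2 * finrank K (LinearMap.range bL) + d →
      ∃ (c : Fin d → K) (β : Fin d → ((Fin 4 × Fin 4 → K) →ₗ[K] (Fin 4 × Fin 4 → K) →ₗ[K] K)),
        ∀ u : Fin 4 × Fin 4 → K, ∀ y ∈ V, ∃ e₀ e₁ : K, ∀ s : K,
          eval (u + s • y) (perPoly (Fin 4) K) =
            e₀ + s * e₁ + s ^ 2 * ∑ k, c k * (β k u y) ^ 2 := by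
    intro d hd
    obtain ⟨c, β, hcβ⟩ := sum_sq_of_isotropic_defect_bilinear hD hDs bL CL hCs
      (fun z => eval z (perPoly (Fin 4) K)) hκ hi hii hiii d hd
    exact ⟨c, β, fun u y hy => hcβ u y (LinearMap.mem_ker.1 hy)⟩
  have hr : finrank K (LinearMap.range bL) = 8 ∨ finrank K (LinearMap.range bL) = 9 ∨
      finrank K (LinearMap.range bL) = 10 ∨ finrank K (LinearMap.range bL) = 11 ∨
      finrank K (LinearMap.range bL) = 12 := by omega
  rcases hr with h8 | h9 | h10 | h11 | h12
  · obtain ⟨c, β, hcβ⟩ := family 9 (by omega)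
    exact not_joint_nine_squares_fin K V hV3 (by omega) c β hcβ
  · obtain ⟨c, β, hcβ⟩ := family 7 (by omega)
    refine noLowRank_seven₇ V hV3 (by omega) c fun y hy => ⟨fun k => (β k).flip y, fun u => ?_⟩
    obtain ⟨e₀, e₁, he⟩ := hcβ u y hy
    exact ⟨e₀, e₁, fun s => by simpa only [LinearMap.flip_apply] using he s⟩
  · obtain ⟨c, β, hcβ⟩ := family 5 (by omega)
    exact H106₅ V hV3 (by omega) c β hcβ
  · obtain ⟨c, β, hcβ⟩ := family 3 (by omega)
    have h4 := finrank_le_four_of_sum_sq_swap (ι := Fin 3) (by rw [Fintype.card_fin]; norm_num) V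
      fun y hy => ⟨c, fun k => (β k).flip y, fun u => by
        obtain ⟨e₀, e₁, he⟩ := hcβ u y hy
        exact ⟨e₀, e₁, fun s => by simpa only [LinearMap.flip_apply] using he s⟩⟩
    omega
  · exact false_of_rank_twelve_le_twentySix K hm hD hDs hCs hκ hi hii hiii hcard hrn hN h12

/-- **No symmetric affine determinantal representation of `per_4` of size `≤ 26`, given `H106₅`.**
[folklore] -/
theorem false_of_le_twentySix_of_H106₅
    (H106₅ : ∀ V : Submodule K (Fin 4 × Fin 4 → K),
      (∀ x ∈ V, ∀ (r c : Fin 3 → Fin 4), Function.Injective r → Function.Injective c →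
        ((Matrix.of fun i j => x (i, j)).submatrix r c).permanent = 0) →
      finrank K V = 6 → ∀ (c : Fin 5 → K)
        (β : Fin 5 → ((Fin 4 × Fin 4 → K) →ₗ[K] (Fin 4 × Fin 4 → K) →ₗ[K] K)),
      ¬ (∀ u : Fin 4 × Fin 4 → K, ∀ y ∈ V, ∃ e₀ e₁ : K, ∀ s : K,
          eval (u + s • y) (perPoly (Fin 4) K) = e₀ + s * e₁ + s ^ 2 * ∑ k, c k * (β k u y) ^ 2))
    {m : ℕ} (hm : m ≤ 26) {A : Matrix (Fin m) (Fin m) (MvPolynomial (Fin 4 × Fin 4) K)}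
    (hS : A.IsSymm) (hA : IsAffineDetRepr (perPoly (Fin 4) K) A) : False := by
  have h := twentySeven_le_of_H106₅ K H106₅ hS hA
  omega

/-- **`27 ≤ sdc(per₄)` given `H106₅`** (the tree's unconditional window is `25 ≤ sdc(per₄) ≤ 29`).
[folklore] -/
theorem sdc_perPoly_four_twentySeven_le_of_H106₅
    (H106₅ : ∀ V : Submodule K (Fin 4 × Fin 4 → K),
      (∀ x ∈ V, ∀ (r c : Fin 3 → Fin 4), Function.Injective r → Function.Injective c →
        ((Matrix.of fun i j => x (i, j)).submatrix r c).permanent = 0) →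
      finrank K V = 6 → ∀ (c : Fin 5 → K)
        (β : Fin 5 → ((Fin 4 × Fin 4 → K) →ₗ[K] (Fin 4 × Fin 4 → K) →ₗ[K] K)),
      ¬ (∀ u : Fin 4 × Fin 4 → K, ∀ y ∈ V, ∃ e₀ e₁ : K, ∀ s : K,
          eval (u + s • y) (perPoly (Fin 4) K) = e₀ + s * e₁ + s ^ 2 * ∑ k, c k * (β k u y) ^ 2)) :
    27 ≤ symmDeterminantalComplexity (perPoly (Fin 4) K) := by
  letI : Invertible (2 : K) := invertibleOfNonzero two_ne_zero
  obtain ⟨A, hS, hA⟩ :=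
    hasSymmDetRepr_symmDeterminantalComplexity
      ⟨_, SymPencilSdcPerThreeWindow.hasSymmDetRepr_perPoly_quarez K 4⟩
  exact twentySeven_le_of_H106₅ K H106₅ hS hA

end Summit.ValiantsHypothesis.ValiantsHypothesis.Theorems.SymPencilSdcPerFourTwentySeven

end
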